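import Mathlib.RepresentationTheory.Irreducible
import Mathlib.FieldTheory.IsAlgClosed.Basic
import Literature.NumberTheory.GaloisRepresentations.FramedRepTwist
import Literature.NumberTheory.GaloisRepresentations.AbsGaloisOuterConj
import Literature.NumberTheory.GaloisRepresentations.GaloisRep
import HarnessLib

/-!
# Representations with the same irreducible restriction to a normal subgroup differ by a twist

Topic `NumberTheory/GaloisRepresentations`; namespace `Literature.NumberTheory.GaloisRepresentations`.
Theorems only: **no definition and no named fact is introduced**.

Let `f : H →ₜ* G` be a continuous homomorphism of topological groups whose image is normalised by
`G` (`∀ g h, ∃ h', g · f h · g⁻¹ = f h'`), `A` an algebraically closed topological field, and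
`ρ, ρ₀ : G →ₜ* GL_n(A)` framed continuous representations which AGREE on `H` (`ρ ∘ f = ρ₀ ∘ f`) with
IRREDUCIBLE common restriction.  Then there is a continuous character `χ : G →ₜ* Aˣ`, trivial on
`f(H)`, with `ρ = ρ₀ ⊗ χ` (`FramedRep.exists_twist_of_comp_eq`).  Proof (Clifford 1937, §§2–3 /
Schur): for `g ∈ G` the element `ρ₀(g)⁻¹ ρ(g)` commutes with the irreducible `ρ₀(f(H))`
(normality + agreement on `H`), hence is a scalar `χ(g)` by Schur's lemma (Mathlib
`Representation.IsIrreducible.algebraMap_intertwiningMap_bijective_of_isAlgClosed`); `χ` is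
multiplicative because scalars are central, continuous as a matrix entry of a continuous map, and
trivial on `f(H)`.

For a Galois extension of fields `M/F` and `f = absGaloisRestrict F M : Γ_M →ₜ* Γ_F` (normal image,
`conj_absGaloisRestrict_mem_range`) this is the classical statement that two Galois representations
of `Γ_F` with the same irreducible restriction to `Γ_M` differ by a character of `Γ_F` trivial on
`Γ_M`, i.e. by a character of `Gal(M/F)` (`FramedGaloisRep.exists_twist_of_restrictField_eq`); the
conjugacy-class form (`…_of_conj_restrictField`) is the one used in descent arguments (two
candidates `ρ`, `ρ₀` over `F` whose restrictions to `Γ_M` are isomorphic and irreducible satisfy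
`ρ ≃ ρ₀ ⊗ χ`) — e.g. the uniqueness-up-to-twist step of cyclic descent of automorphy
(Arthur–Clozel 1989, Ch. 3 Thm. 4.2 (b): the fibres of cyclic base change are the twists by
characters of `Gal(M/F)`), of which this file is the Galois-side counterpart.

## Main results

* `FramedRep.IsIrreducible.rank_pos` — an irreducible framed representation has rank `> 0`.
* `FramedRep.exists_eq_scalar_of_forall_commute` — Schur: a matrix commuting with the image of an
  irreducible framed representation over an algebraically closed field is scalar.
* `FramedRep.exists_twist_of_comp_eq` — the abstract twist theorem (normal image).
* `FramedGaloisRep.exists_twist_of_restrictField_eq`, `FramedGaloisRep.exists_twist_of_conj_restrictField`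
  — the Galois forms, for `M/F` Galois.

## References

* A. H. Clifford, *Representations induced in an invariant subgroup*, Ann. of Math. 38 (1937),
  533–550, §§2–3. [Clifford1937]
* J.-P. Serre, *Linear representations of finite groups*, GTM 42, §8.1 (representations of a normal
  subgroup; conjugates), §2.2 (Schur's lemma).
* J. Arthur, L. Clozel, *Simple algebras, base change, and the advanced theory of the trace formula*,
  Ann. of Math. Stud. 120 (1989), Ch. 3 Thm. 4.2. [ArthurClozelAMS120]
-/

noncomputable section

namespace Literature.NumberTheory.GaloisRepresentations

universe u u' v

section Abstract

variable {G : Type u} {H : Type u'} [Group G] [TopologicalSpace G] [Group H] [TopologicalSpace H]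
  {A : Type v} [Field A] [TopologicalSpace A] [IsTopologicalRing A] {n : ℕ}

namespace FramedRep

omit [IsTopologicalRing A] in
/-- An irreducible framed representation has positive rank (the zero representation is not
irreducible: its lattice of subrepresentations is trivial). [folklore] -/
theorem IsIrreducible.rank_pos {r : FramedRep H A n} (hirr : r.IsIrreducible) : 0 < n := by
  rcases Nat.eq_zero_or_pos n with hn | hn
  · subst hn
    haveI : Representation.IsIrreducible r.toRepresentation := hirr
    exact absurd (Subrepresentation.toSubmodule_injective (Subsingleton.elim _ _))
      (bot_ne_top (α := Subrepresentation r.toRepresentation))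
  · exact hn

omit [TopologicalSpace A] [IsTopologicalRing A] in
/-- The `(i, i)` entry of the scalar matrix `algebraMap A _ c` is `c`. [folklore] -/
theorem algebraMap_matrix_apply_same (c : A) (i : Fin n) :
    algebraMap A (Matrix (Fin n) (Fin n) A) c i i = c := by
  rw [Matrix.algebraMap_matrix_apply, if_pos rfl, Algebra.algebraMap_self_apply]

omit [IsTopologicalRing A] in
/-- **Schur's lemma, matrix form.** If `r : H →ₜ* GL_n(A)` is irreducible over the algebraically
closed field `A`, every matrix commuting with all `r h` is scalar. (Mathlib
`Representation.IsIrreducible.algebraMap_intertwiningMap_bijective_of_isAlgClosed`, transported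
along `Matrix.toLin'`.) [folklore] -/
theorem exists_eq_scalar_of_forall_commute [IsAlgClosed A] {r : FramedRep H A n}
    (hirr : r.IsIrreducible) (M : Matrix (Fin n) (Fin n) A)
    (hM : ∀ h : H, M * ((r h : GL (Fin n) A) : Matrix (Fin n) (Fin n) A) =
      ((r h : GL (Fin n) A) : Matrix (Fin n) (Fin n) A) * M) :
    ∃ c : A, M = algebraMap A (Matrix (Fin n) (Fin n) A) c := by
  haveI : Representation.IsIrreducible r.toRepresentation := hirr
  -- `v ↦ M v` intertwines `r.toRepresentation` with itself
  let φ : Representation.IntertwiningMap r.toRepresentation r.toRepresentation :=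
    LinearMap.intertwiningMap_of_isIntertwiningMap r.toRepresentation r.toRepresentation
      (Matrix.toLin' M) fun h v => by
        simp only [toRepresentation_apply_apply, Matrix.toLin'_apply, Matrix.mulVec_mulVec, hM h]
  obtain ⟨c, hc⟩ :=
    (Representation.IsIrreducible.algebraMap_intertwiningMap_bijective_of_isAlgClosed
      (ρ := r.toRepresentation)).2 φ
  refine ⟨c, ?_⟩
  have hφ : ∀ v : Fin n → A, M.mulVec v = c • v := fun v => by
    have h1 := congrArg (fun ψ : Representation.IntertwiningMap r.toRepresentation
      r.toRepresentation => ψ v) hc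
    simp only [Representation.IntertwiningMap.algebraMap_apply,
      Representation.IntertwiningMap.smul_apply] at h1
    -- `h1 : c • (1 : IntertwiningMap) v = φ v`, and `φ v = M *ᵥ v`, `(1 : IntertwiningMap) v = v`
    exact h1.symm
  apply Matrix.toLin'.injective
  refine LinearMap.ext fun v => ?_
  rw [Matrix.toLin'_apply, Matrix.toLin'_apply, hφ v, Algebra.algebraMap_eq_smul_one,
    Matrix.smul_mulVec, Matrix.one_mulVec]

/-- **Two framed representations with the same irreducible restriction to a normal subgroup differ by
a twist** (Clifford 1937 / Schur). Let `f : H →ₜ* G` have image normalised by `G`, and let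
`ρ ρ₀ : G →ₜ* GL_n(A)` (with `A` an algebraically closed topological field) satisfy `ρ ∘ f = ρ₀ ∘ f`
with `ρ₀ ∘ f` irreducible. Then `ρ = ρ₀ ⊗ χ` for a continuous character `χ : G →ₜ* Aˣ` trivial on
`f(H)`: `χ(g)` is the scalar `ρ₀(g)⁻¹ρ(g)` (it commutes with the irreducible `ρ₀(f(H))`).
[cite: Clifford1937, §§2–3] -/
theorem exists_twist_of_comp_eq [IsAlgClosed A] (f : H →ₜ* G)
    (hnorm : ∀ (g : G) (h : H), ∃ h' : H, g * f h * g⁻¹ = f h')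
    (ρ ρ₀ : FramedRep G A n) (hirr : FramedRep.IsIrreducible (ρ₀.comp f))
    (heq : ρ.comp f = ρ₀.comp f) :
    ∃ χ : G →ₜ* Aˣ, (∀ h : H, χ (f h) = 1) ∧ ρ = ρ₀.twist χ := by
  have hn : 0 < n := hirr.rank_pos
  have heq' : ∀ h : H, ρ (f h) = ρ₀ (f h) := fun h => by
    have := congrArg (fun σ : FramedRep H A n => σ h) heq
    exact this
  -- the candidate scalar `X g := ρ₀(g)⁻¹ ρ(g)` commutes with every `ρ₀(f h)`
  let X : G → GL (Fin n) A := fun g => (ρ₀ g)⁻¹ * ρ g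
  have hXdef : ∀ g, X g = (ρ₀ g)⁻¹ * ρ g := fun g => rfl
  have hcomm : ∀ (g : G) (h : H), X g * ρ₀ (f h) = ρ₀ (f h) * X g := by
    intro g h
    obtain ⟨h', hh'⟩ := hnorm g h
    -- `ρ (g · f h · g⁻¹) = ρ₀ (g · f h · g⁻¹)`: both are the common value at `f h'`
    have key : ρ (g * f h * g⁻¹) = ρ₀ (g * f h * g⁻¹) := by rw [hh', heq']
    simp only [map_mul, map_inv, heq'] at key
    -- `key : ρ g * ρ₀ (f h) * (ρ g)⁻¹ = ρ₀ g * ρ₀ (f h) * (ρ₀ g)⁻¹`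
    rw [hXdef]
    calc (ρ₀ g)⁻¹ * ρ g * ρ₀ (f h)
        = (ρ₀ g)⁻¹ * (ρ g * ρ₀ (f h) * (ρ g)⁻¹) * ρ g := by group
      _ = (ρ₀ g)⁻¹ * (ρ₀ g * ρ₀ (f h) * (ρ₀ g)⁻¹) * ρ g := by rw [key]
      _ = ρ₀ (f h) * ((ρ₀ g)⁻¹ * ρ g) := by group
  -- Schur: `X g` is a scalar matrix
  have hscalar : ∀ g : G, ∃ c : A,
      ((X g : GL (Fin n) A) : Matrix (Fin n) (Fin n) A) = algebraMap A (Matrix (Fin n) (Fin n) A) c :=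
    fun g => exists_eq_scalar_of_forall_commute hirr _ fun h => by
      show ((X g : GL (Fin n) A) : Matrix (Fin n) (Fin n) A) *
          ((ρ₀ (f h) : GL (Fin n) A) : Matrix (Fin n) (Fin n) A) =
        ((ρ₀ (f h) : GL (Fin n) A) : Matrix (Fin n) (Fin n) A) * (X g : GL (Fin n) A)
      rw [← Units.val_mul, ← Units.val_mul, hcomm g h]
  choose c hc using hscalar
  -- the scalar is non-zero (its `n`-th power is `det (X g)`, a unit, and `n > 0`)
  haveI : Nonempty (Fin n) := ⟨⟨0, hn⟩⟩
  have hc0 : ∀ g : G, c g ≠ 0 := fun g h0 => by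
    have hdet := (X g).isUnit.map Matrix.detMonoidHom
    rw [Matrix.coe_detMonoidHom, hc g, h0, map_zero, Matrix.det_zero] at hdet
    exact not_isUnit_zero hdet
  -- … so `X g` is the central element `scalar (c g)`
  let cu : G → Aˣ := fun g => Units.mk0 (c g) (hc0 g)
  have hXs : ∀ g : G, X g = scalar A n (cu g) := fun g => by
    ext1
    rw [hc g, coe_scalar_apply]
    rfl
  have hρ : ∀ g : G, ρ g = scalar A n (cu g) * ρ₀ g := fun g => by
    rw [scalar_mul_comm, ← hXs, hXdef, mul_inv_cancel_left]
  -- reading off the `(0,0)` entry recovers the scalar, so `scalar` is injective here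
  let i₀ : Fin n := ⟨0, hn⟩
  have hentry : ∀ a : Aˣ, ((scalar A n a : GL (Fin n) A) : Matrix (Fin n) (Fin n) A) i₀ i₀ = a :=
    fun a => by rw [coe_scalar_apply, algebraMap_matrix_apply_same]
  have hinj : ∀ a b : Aˣ, scalar A n a = scalar A n b → a = b := fun a b hab => by
    ext; rw [← hentry a, ← hentry b, hab]
  -- the character
  have hmul : ∀ g g' : G, cu (g * g') = cu g * cu g' := fun g g' => by
    apply hinj
    have h1 : ρ (g * g') = scalar A n (cu (g * g')) * ρ₀ (g * g') := hρ (g * g')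
    rw [map_mul ρ, hρ g, hρ g', map_mul ρ₀] at h1
    -- h1 : scalar a ρ₀ g (scalar b ρ₀ g') = scalar (cu (g g')) (ρ₀ g ρ₀ g')
    have h2 : scalar A n (cu g) * ρ₀ g * (scalar A n (cu g') * ρ₀ g') =
        scalar A n (cu g) * scalar A n (cu g') * (ρ₀ g * ρ₀ g') := by
      rw [mul_assoc, ← mul_assoc (ρ₀ g), ← scalar_mul_comm (cu g') (ρ₀ g)]; group
    rw [h2] at h1
    rw [map_mul]
    exact (mul_right_cancel h1).symm
  have hone : cu 1 = 1 := by
    apply hinj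
    rw [map_one, ← hXs, hXdef, map_one, map_one, inv_one, one_mul]
  let χ₀ : G →* Aˣ := { toFun := cu, map_one' := hone, map_mul' := hmul }
  -- continuity: `c g` and `(c g)⁻¹` are matrix entries of the continuous `X g`, `(X g)⁻¹`
  have hXcont : Continuous X :=
    ((map_continuous ρ₀).inv).mul (map_continuous ρ)
  have hcont : Continuous cu := by
    rw [Units.continuous_iff]
    constructor
    · refine ((Units.continuous_val.comp hXcont).matrix_elem i₀ i₀).congr fun g => ?_
      show ((X g : GL (Fin n) A) : Matrix (Fin n) (Fin n) A) i₀ i₀ = (cu g : A)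
      rw [hXs, hentry]
    · refine ((Units.continuous_val.comp hXcont.inv).matrix_elem i₀ i₀).congr fun g => ?_
      show (((X g)⁻¹ : GL (Fin n) A) : Matrix (Fin n) (Fin n) A) i₀ i₀ = ((cu g)⁻¹ : Aˣ)
      rw [hXs, ← map_inv, hentry]
  refine ⟨{ toMonoidHom := χ₀, continuous_toFun := hcont }, fun h => ?_, ?_⟩
  · -- trivial on `f(H)`: `X (f h) = 1`
    apply hinj
    show scalar A n (cu (f h)) = scalar A n 1
    rw [map_one, ← hXs, hXdef, heq', inv_mul_cancel]
  · refine ContinuousMonoidHom.ext fun g => ?_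
    rw [twist_apply]
    exact hρ g

end FramedRep

end Abstract

section Galois

variable {F M : Type*} [Field F] [Field M] [Algebra F M] [IsGalois F M]
  {A : Type v} [Field A] [TopologicalSpace A] [IsTopologicalRing A] [IsAlgClosed A] {n : ℕ}

/-- **Galois representations with the same irreducible restriction to `Γ_M`, `M/F` Galois, differ by a
character of `Gal(M/F)`.** If `ρ ρ₀ : Γ_F → GL_n(A)` (`A` algebraically closed) have the SAME
restriction to `Γ_M` along `absGaloisRestrict F M` and that restriction is irreducible, then
`ρ = ρ₀ ⊗ χ` for a continuous character `χ` of `Γ_F` trivial on (the image of) `Γ_M`.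
(`FramedRep.exists_twist_of_comp_eq` with the normality of `res(Γ_M) ◁ Γ_F`,
`conj_absGaloisRestrict_mem_range`.) [cite: Clifford1937, §§2–3] -/
theorem FramedGaloisRep.exists_twist_of_restrictField_eq (ρ ρ₀ : FramedGaloisRep F A n)
    (hirr : (ρ₀.restrictField M).IsIrreducible) (heq : ρ.restrictField M = ρ₀.restrictField M) :
    ∃ χ : Field.absoluteGaloisGroup F →ₜ* Aˣ,
      (∀ σ : Field.absoluteGaloisGroup M, χ (absGaloisRestrict F M σ) = 1) ∧ ρ = ρ₀.twist χ :=
  FramedRep.exists_twist_of_comp_eq (absGaloisRestrict F M)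
    (fun τ σ => by
      obtain ⟨σ', h⟩ := conj_absGaloisRestrict_mem_range F M τ σ
      exact ⟨σ', h.symm⟩)
    ρ ρ₀ hirr heq

/-- **Conjugacy-class form** (the shape used in descent arguments, cf. `Summit.Langlands.IsConjugate`):
if the restrictions to `Γ_M` of `ρ ρ₀ : Γ_F → GL_n(A)` are CONJUGATE, `P · ρ|_{Γ_M} · P⁻¹ = ρ₀|_{Γ_M}`,
and irreducible, then `P ρ P⁻¹ = ρ₀ ⊗ χ` for a continuous character `χ` of `Γ_F` trivial on `Γ_M` —
`ρ` is isomorphic to a twist of `ρ₀` by a character of `Gal(M/F)`. [cite: Clifford1937, §§2–3] -/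
theorem FramedGaloisRep.exists_twist_of_conj_restrictField (ρ ρ₀ : FramedGaloisRep F A n)
    (hirr : (ρ₀.restrictField M).IsIrreducible)
    (hconj : ∃ P : GL (Fin n) A, FramedRep.conj P (ρ.restrictField M) = ρ₀.restrictField M) :
    ∃ (χ : Field.absoluteGaloisGroup F →ₜ* Aˣ) (P : GL (Fin n) A),
      (∀ σ : Field.absoluteGaloisGroup M, χ (absGaloisRestrict F M σ) = 1) ∧
        FramedRep.conj P ρ = ρ₀.twist χ := by
  obtain ⟨P, hP⟩ := hconj
  have h : FramedGaloisRep.restrictField M (FramedRep.conj P ρ : FramedGaloisRep F A n) =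
      ρ₀.restrictField M := by
    rw [← hP]
    exact ContinuousMonoidHom.ext fun _ => rfl
  obtain ⟨χ, hχ, h2⟩ := FramedGaloisRep.exists_twist_of_restrictField_eq (FramedRep.conj P ρ) ρ₀ hirr h
  exact ⟨χ, P, hχ, h2⟩

end Galois

end Literature.NumberTheory.GaloisRepresentations

end
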